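import Literature.NumberTheory.LFunctions.IwaniecSarnakFamilyWeightTwo
import HarnessLib

/-!
# The weight-2 decision theorem with the ½-proportion edge asked at PRIME levels only
# (Iwaniec 2006 §7 (7.7); continuation of `IwaniecSarnakFamilyWeightTwo`)

Topic `Literature/NumberTheory/LFunctions` (namespace
`Literature.NumberTheory.LFunctions.CentralValueFamilyHalfEdge`). PROOFS only — no definition, no
named fact (D-0026). Cell `landau-siegel`, §C typing for §D edge fam.

`lOne_lowerBound_of_untwistedProportion_weightTwo` (`IwaniecSarnakFamilyWeightTwo`) asks the edge
in its record form `IwaniecSarnak.UntwistedProportion 2 (½ + η)` — (7.5) for a harmonic proportion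
`> ½` of the even newforms at EVERY large squarefree level — but consumes it only at the prime levels
`p ≡ −1 (mod D)` supplied by Linnik. Here the edge is asked exactly where it is used:
`primeLevelFamilyTwo.EStarFam p₁ 2` with `p₁ > ½` (prime levels, weight `2`), all other hypotheses
being the same typed statements in print (Lapid–Rallis non-negativity, the twisted half (7.6) at `½`,
the mixed moment (7.3)+(7.4) against the total mass, Kowalski–Michel's Petersson facts). The
record-form edge implies the prime-level one (`primeLevelFamilyTwo_EStarFam_of_untwistedProportion`).

WHAT THIS IS NOT: no claim that the edge holds. «The programme SEARCHES and TYPES; no claim about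
Landau–Siegel zeros, Theorems 1–2 of arXiv:2211.02515 or a repaired Margin232 until a kernel theorem
says so.»

## References

* [IwaniecConversations2006] H. Iwaniec, LNM 1891 (2006), §7 (7.5)–(7.7), p. 97 (held p0096–p0097).
* Tree: `IwaniecSarnakFamilyWeightTwo` (p467198), `CentralValueFamilyNontrivialTwist` (p466418).
-/

noncomputable section

namespace Literature.NumberTheory.LFunctions.CentralValueFamilyHalfEdge

open Literature.NumberTheory.LFunctions.IwaniecSarnak

/-- **The weight-2 decision theorem with the edge at PRIME levels only.** Printed hypotheses:
`lapidRallis2003_theorem1_gl2Twist`, `iwaniec2006_twistedHalf`, `iwaniec2006_mixedMomentOverMass`,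
`kowalskiMichel2000_petersson`, `kowalskiMichel2000_lemma1`; the EDGE: `primeLevelFamilyTwo.EStarFam p₁ 2`
with `p₁ > ½` — (7.5) for a harmonic proportion `≥ p₁` of the even newforms of weight `2` at every
large PRIME level. Conclusion: `∃ c > 0, L(1,χ_D) ≥ c·(log D)⁻⁴` for all large `D`, all real primitive
`χ mod D`. The sharpest typed target of the pointwise fam edge at `k = 2` is therefore
`∃ p₁ > ½, primeLevelFamilyTwo.EStarFam p₁ 2`. [cite: IwaniecConversations2006, §7 (7.7) and p. 97] -/
theorem lOne_lowerBound_of_EStarFam_prime_weightTwo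
    (hLR : lapidRallis2003_theorem1_gl2Twist) (hTw : iwaniec2006_twistedHalf)
    (hMix : iwaniec2006_mixedMomentOverMass)
    (hP : KowalskiMichel2000.kowalskiMichel2000_petersson)
    (hL : KowalskiMichel2000.kowalskiMichel2000_lemma1)
    {p₁ : ℝ} (hp : 1 / 2 < p₁) (hE : primeLevelFamilyTwo.EStarFam p₁ 2) :
    ∃ c : ℝ, 0 < c ∧ ∃ D₀ : ℕ, ∀ (D : ℕ) [NeZero D] (χ : DirichletCharacter ℂ D), D₀ ≤ D →
      χ.IsPrimitive → MulChar.IsQuadratic χ →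
        c * ((Real.log D) ^ 4)⁻¹ ≤ (χ.LFunction 1).re := by
  have hk : (2 : ℤ) ≤ 2 := le_rfl
  have hkev : Even (2 : ℤ) := ⟨1, rfl⟩
  obtain ⟨δ₁, hδ₁, htot⟩ := mixedOverTotalMass_iwaniecSarnakFamily hk hkev hMix
  have hε : 0 < (p₁ - 1 / 2) / 2 := by linarith
  obtain ⟨δ₂, hδ₂, htw⟩ := TwistedHalf_of_twistedProportion hε (hTw 2 hk hkev)
  have hδ : 0 < min δ₁ δ₂ := lt_min hδ₁ hδ₂
  obtain ⟨K, hK, hsup⟩ := primeLevelFamilyTwo_compatibleSupply hδ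
  have h := primeLevelFamilyTwo.lOne_lowerBound_of_EStarFam_total' hK
    (primeLevelFamilyTwo_nonnegOn hLR) (fun _ _ _ _ hcomp => CentralValueFamily.refine_compatible_B hcomp)
    (evenShare_primeLevelFamilyTwo hP hL)
    (CentralValueFamily.refine_mixedOverTotalMass (htot.anti (min_le_left _ _)))
    (CentralValueFamily.refine_twistedHalf (htw.anti (min_le_right _ _)))
    hE (by linarith) hsup
  simpa only [show (2 * 2 : ℕ) = 4 from rfl] using h

/-- The record-form edge at all squarefree levels implies the prime-level edge (restriction; `ε`
slack from the asymptotic reading of the record). [cite: IwaniecConversations2006, §7 (7.5)] -/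
theorem primeLevelFamilyTwo_EStarFam_of_untwistedProportion {p ε : ℝ} (hε : 0 < ε)
    (h : UntwistedProportion 2 p) : primeLevelFamilyTwo.EStarFam (p - ε) 2 :=
  CentralValueFamily.refine_EStarFam (EStarFam_of_untwistedProportion hε h)

end Literature.NumberTheory.LFunctions.CentralValueFamilyHalfEdge

end
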